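import Summits.RiemannHypothesis.RiemannHypothesis.Theorems.SemilocalNegCertUptoHundredThirtyNineKinked
import Summits.RiemannHypothesis.RiemannHypothesis.Theorems.SemilocalPiecewiseCertFlex
import HarnessLib

/-!
# Semi-local threshold of the `{∞} ∪ {p < 149}` form, negative side: `a*({2,…,139}) ≤ 321/128` — the wall `q = 149` from a KINKED (piecewise-cubic) witness (fact file 39 of 39 after the gen14 re-cut to ≤ 6 facts per file — gate limit 600 s —: the kernel facts piece 599 … piece 604 of 605, FLEX layout (each file of piece facts imports part 1 only))

Cell `rh-explicit` (HOME `run/shared/lean/pub/rh-explicit/`), seat cc-s2-4 (A4 SEMILOCAL-TABLE, kernel column; pipeline gen11 `mkkinked.py`).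
Honest framing: theorems about the tree's `weilSemilocalThreshold S`; nothing here bears on RH.  No data is trusted: every bound is a
`decide +kernel` fact of the piecewise certificate `SemilocalPiecewiseCert.lean` (cc-s2-4 gen8).

Instance: `S = {p < 149}`, window `b = 321/128` (last /1024 value below `(log 151)/2`), `N = 150`, 47 atoms; odd piecewise-cubic
witness with 24 slope breaks at the atom images `|b − log n|` nearest `0` (atoms `n = 13, 11, 16, 9, 17, 8, 19, 7, 23, 25, 27, 29, 5, 31, 32, 37, 4, 41, 43, 47, 49, 3, 53, 59`,
rounded to `/1024`); float finder `Re Q/‖G‖² = -1.416e-04` (no polar credit); orders `(10, 4, 8, 4, 10, 40)`, 605 `t`-pieces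
(far widths ≤ 1/4); exact kernel margin `(rhs − lhs)/‖G‖² = 1.4144e-04`.  ⇒ **`a*({p < 149}) ≤ 321/128 < (log 151)/2`**.
The instance is split for the gate into part 1
(table, certificate, `checkMainPW`, the atom side in kernel chunks of ≤ 4 atoms via `SemilocalPiecewiseCertSplit.lean`), parts 2–10
(68 piece facts each in the FLEX layout of `SemilocalPiecewiseCertFlex.lean` (cc-s2-4 gen12, CC4-LEAN §17.2): piece `0` by `checkPiecePW`,
every far piece by `checkPieceFlex i ⟨n, m, K, m', u₀⟩` with the orders that piece needs (mean majorant degree ≈ 62 instead of 176) and a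
short dyadic centre `u₀ ≤ u_K(T₀)` — same witness, same cuts, claims recomputed (`⌈exact⌉ + 1`), kernel margin `1.4142e-04`·‖G‖²; each
fact file imports part 1 only), the Pieces part (composition) and the Final part (theorems).  Folklore throughout.
-/

set_option autoImplicit false
set_option linter.dupNamespace false  -- the mandated namespace repeats `RiemannHypothesis`
set_option Elab.async false  -- serialise the kernel facts: in parallel they exhaust the node's per-process heap (cc-s2-4 gen11, CC4-LEAN §16.10)

noncomputable section

open Complex Filter Set MeasureTheory Topology
open scoped Real

namespace Summit.RiemannHypothesis.RiemannHypothesis.Theorems.SemilocalPolyWitness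

open MeasureTheory Set Finset Real
open Literature.NumberTheory.LFunctions
open Summit.RiemannHypothesis.RiemannHypothesis.Theorems.MotivicDoor
open Summit.RiemannHypothesis.RiemannHypothesis.Theorems.MotivicDoor.SemilocalThreshold
open Summit.RiemannHypothesis.RiemannHypothesis.Theorems.MotivicDoor.SemilocalMarkov
open LQ

set_option maxHeartbeats 0 in
/-- kernel fact: piece `599` of `certUptoHundredThirtyNineKinked` (`t ∈ [4011/1024, 2033/512]`), orders `(10, 3, 8, 2)`, centre `22698323/4194304`. -/
theorem check_UptoHundredThirtyNineKinked_piece599 : certUptoHundredThirtyNineKinked.checkPieceFlex 599 ⟨10, 3, 8, 2, 22698323 / 4194304⟩ = true := by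
  decide +kernel

set_option maxHeartbeats 0 in
/-- kernel fact: piece `600` of `certUptoHundredThirtyNineKinked` (`t ∈ [2033/512, 4175/1024]`), orders `(10, 4, 8, 2)`, centre `23799531/4194304`. -/
theorem check_UptoHundredThirtyNineKinked_piece600 : certUptoHundredThirtyNineKinked.checkPieceFlex 600 ⟨10, 4, 8, 2, 23799531 / 4194304⟩ = true := by
  decide +kernel

set_option maxHeartbeats 0 in
/-- kernel fact: piece `601` of `certUptoHundredThirtyNineKinked` (`t ∈ [4175/1024, 17661/4096]`), orders `(10, 4, 8, 3)`, centre `104531363/16777216`. -/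
theorem check_UptoHundredThirtyNineKinked_piece601 : certUptoHundredThirtyNineKinked.checkPieceFlex 601 ⟨10, 4, 8, 3, 104531363 / 16777216⟩ = true := by
  decide +kernel

set_option maxHeartbeats 0 in
/-- kernel fact: piece `602` of `certUptoHundredThirtyNineKinked` (`t ∈ [17661/4096, 9311/2048]`), orders `(10, 4, 8, 3)`, centre `64138975/8388608`. -/
theorem check_UptoHundredThirtyNineKinked_piece602 : certUptoHundredThirtyNineKinked.checkPieceFlex 602 ⟨10, 4, 8, 3, 64138975 / 8388608⟩ = true := by
  decide +kernel

set_option maxHeartbeats 0 in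
/-- kernel fact: piece `603` of `certUptoHundredThirtyNineKinked` (`t ∈ [9311/2048, 19583/4096]`), orders `(10, 4, 8, 3)`, centre `157181057/16777216`. -/
theorem check_UptoHundredThirtyNineKinked_piece603 : certUptoHundredThirtyNineKinked.checkPieceFlex 603 ⟨10, 4, 8, 3, 157181057 / 16777216⟩ = true := by
  decide +kernel

set_option maxHeartbeats 0 in
/-- kernel fact: piece `604` of `certUptoHundredThirtyNineKinked` (`t ∈ [19583/4096, 321/64]`), orders `(10, 4, 8, 3)`, centre `751543/65536`. -/
theorem check_UptoHundredThirtyNineKinked_piece604 : certUptoHundredThirtyNineKinked.checkPieceFlex 604 ⟨10, 4, 8, 3, 751543 / 65536⟩ = true := by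
  decide +kernel

end Summit.RiemannHypothesis.RiemannHypothesis.Theorems.SemilocalPolyWitness

end
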